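import Summits.Ventures.QEC.CircuitDistance.PortCoverBase
import Summits.Ventures.QEC.CircuitDistance.PortTablesBB144
import HarnessLib

/-!
# P3-PORT instance `[[144,12,12]]`: shared definitions for the leaf ENTRY files (cell `qec`, experiment CDX, seat qec-cdx-type-1)

Flat index ↦ `Mono ⊕ Mono` for `(ℓ, m) = (12, 6)` (eng-1's convention `L: 6a+b`, `R: 72 + 6a+b`), words as supports, and the
per-leaf hypothesis bundles `LeafOKX` / `LeafOKZ` of the sector theorems `no_xLogical_of_leavesC` / `no_zLogical_of_leavesC` at
`S = bb144SM`, `N₀ = 9`, `w = 9` (coverage in SEMANTIC form, discharged per leaf by `covers₂` + `xcovers₂_sound`).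
(A₁,A₂,A₃)=(x³,y,y²) per SI p.10 L83; (B₁,B₂,B₃)=(y³,x,x²) per print's positional convention; authors' software labelling = provenance (acq-14097 pending).  No `native_decide`; nothing here asserts a value of `d_circ`.
-/

namespace Summit.Ventures.QEC.CircuitDistance

open Literature.InformationTheory.QuantumCodes

/-- Flat qubit index of eng-1's `[[144,12,12]]` leaf words ↦ column index `Mono ⊕ Mono`. -/
def flatQ144 (n : ℕ) : BB.Mono 12 6 ⊕ BB.Mono 12 6 :=
  if n < 72 then Sum.inl (Fin.ofNat 12 (n / 6), Fin.ofNat 6 (n % 6))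
  else Sum.inr (Fin.ofNat 12 ((n - 72) / 6), Fin.ofNat 6 ((n - 72) % 6))

/-- A leaf word (generator supports as flat indices, in group order) as supports in `Mono ⊕ Mono`. -/
def wordOf144 (w : List (List ℕ)) : List (Finset (BB.Mono 12 6 ⊕ BB.Mono 12 6)) := w.map fun g => (g.map flatQ144).toFinset

/-- The per-leaf hypothesis bundle of `no_xLogical_of_leavesC` for `[[144,12,12]]` (`N₀ = 9`, `w = 9`). -/
def LeafOKX (e : LeafEntry 12 6) : Prop :=
  e.leaf.wf = true ∧ Fibre.Covers₀ (xDEM bb144SM bb144XTable 9) (scope 9) encDet e.word e.leaf ∧ e.word.Nodup ∧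
    e.leaf.w = 9 ∧ e.leaf.budget ≤ 1 ∧ ¬ e.leaf.Realised

/-- The per-leaf hypothesis bundle of `no_zLogical_of_leavesC` for `[[144,12,12]]`. -/
def LeafOKZ (e : LeafEntry 12 6) : Prop :=
  e.leaf.wf = true ∧ Fibre.Covers₀ (zDEM bb144SM bb144ZTable 9) (scope 9) encDet e.word e.leaf ∧ e.word.Nodup ∧
    e.leaf.w = 9 ∧ e.leaf.budget ≤ 1 ∧ ¬ e.leaf.Realised

/-- Packing an `X` entry from its kernel checks. -/
theorem xentry144_ok_of {e : LeafEntry 12 6} (hwf : e.leaf.wf = true) (hcov : bb144XTable.covers₂ bb144SM 9 e = true)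
    (hnd : e.word.Nodup) (hw : e.leaf.w = 9) (hb : e.leaf.budget ≤ 1) (hnr : ¬ e.leaf.Realised) : LeafOKX e :=
  ⟨hwf, xcovers₂_sound bb144SM bb144XTable bb144XTable_shapeCorrect 9 e hcov, hnd, hw, hb, hnr⟩

/-- Packing a `Z` entry from its kernel checks. -/
theorem zentry144_ok_of {e : LeafEntry 12 6} (hwf : e.leaf.wf = true) (hcov : bb144ZTable.covers₂ bb144SM 9 e = true)
    (hnd : e.word.Nodup) (hw : e.leaf.w = 9) (hb : e.leaf.budget ≤ 1) (hnr : ¬ e.leaf.Realised) : LeafOKZ e :=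
  ⟨hwf, zcovers₂_sound bb144SM bb144ZTable bb144ZTable_shapeCorrect 9 e hcov, hnd, hw, hb, hnr⟩

end Summit.Ventures.QEC.CircuitDistance
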